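import Summits.BirchSwinnertonDyer.BirchSwinnertonDyer.Theorems.ByReductionTypeAtTwoMultTransportTwistedDescentTateLine
import Literature.NumberTheory.GaloisRepresentations.LocalDualityTwoZero
import Literature.NumberTheory.GaloisRepresentations.ContinuousCohomologyMultiplicationSequences
import Literature.NumberTheory.Automorphic.AdicCompletionLocalField
import HarnessLib

/-!
# T-42-mult in the kernel, XXXVIII: `#H²(ℚ_v, C_n(χ_u)) ≤ |u − 1|` for the twisted Tate line at the
# prime `2`, hence `2^{|u−1|} · H²(ℚ_v, C_n(χ_u)) = 0`

Cell `bsd-2adic` (run/shared/lean/pub/bsd-2adic/), seat `bsd-2adic-t42` (BRIEF-T42), GEN 17. HONEST FRAMING: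
research route; THEOREMS ONLY (no `def`, no named fact, no instance); nothing booked; nothing re-keyed
(RC-169); BSD is not proved by any of this. PARTITION: X5@2 multiplicative GV-transport rows (K4ᵐ O1
`MultCongruenceTransportAtTwo`; the residual `T2` of `hF3b_of_prop49_T2`, file XXX) × p = 2 — types-the-object-of;
bears_on K4 items 19922 / 19923 (`--supports stmt-BirchSwinnertonDyer-19923`). Brick (e) of
HOME/t42/DESIGN-T42-ADDENDUM-18.md §A18.3: the bound that kills the lifting obstruction
`δ₁[ξ] ∈ H²(Γ_{ℚ_v}, C_J(χ_u))` after raising the level by `m = |u − 1|`.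

## What

Let `v ∋ 2`, `F = ℚ_v`, `κ` the cyclotomic `ℤ_2`-extension, `u ≡ 1 (mod 2)`, `u ≠ 1`, and let
`C ⊆ E[2^n]` be a `Γ_F`-stable line for the TWISTED action `χ_u` (the restriction to `Γ_F` of the tree's
`twistedTorsionGaloisModule`), cyclic (`C = ℕ c₀`), on which some `σ₀ ∈ Γ_F` with `κ(σ₀|_ℚ̄) = γ`
(the topological generator) acts through the SAME exponent `a` as on `μ_{2^n}(F̄)` (`σ₀ζ = ζ^a ⇒ σ₀c = a c`;
for the Tate line this is file XXXVII (iv) with `σ₀` inertial, file XXXIV).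

* `exists_exponent_rootsOfUnity` — every `σ ∈ Γ_F` acts on `μ_N(F̄)` as `ζ ↦ ζ^a` for some `a : ℕ`
  admitting `a'` with `ζ^{aa'} = ζ` on `μ_N` (`μ_N` is cyclic).
* `natCard_two_line_le` — **`#H²(F, C(χ_u)) ≤ |u − 1|`**.  Proof: by local Tate duality in bidegree `(2,0)`
  (tree `natCard_two_eq_natCard_invariants_homRep`, Serre II §5.2 Thm. 2 / Milne ADT I Cor. 2.3)
  `#H²(F, C(χ_u)) = #Hom_{Γ_F}(C(χ_u), μ_{2^n})`.  An equivariant `f` satisfies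
  `a·f(c) = σ₀ f(c) = f(σ₀ ⋆ c) = f(u a c) = u a·f(c)`, so `a(u−1) f(c) = 0`, and `a` is invertible on
  `μ_{2^n}` (`ζ^{aa'} = ζ`), so `(u−1) f(c) = 0`: `f ↦ f(c₀)` embeds the equivariant maps into
  `μ_{2^n}[u−1]`, which has at most `|u−1|` elements in the cyclic group `μ_{2^n}`
  (`IsAddCyclic.card_nsmul_eq_zero_le`).
* `two_pow_natAbs_smul_two_line_eq_zero` — hence **`2^{|u−1|} y = 0` for every `y ∈ H²(F, C(χ_u))`**
  (`y` has `2`-power order dividing `#H² ≤ |u−1| < 2^{|u−1|}`).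

References: [SerreGaloisCohomology1997] II §5.2 Thm. 2; [MilneADT2006] I Cor. 2.3; [GreenbergLNM1716] §4
pp. 107, 124 (the twisted modules `A_s`); [GreenbergVatsal2000] §2 p. 14 (`C ≅ μ_{p^∞} ⊗ ψ`).
-/

set_option autoImplicit false
set_option linter.dupNamespace false

noncomputable section

open scoped Classical

namespace Summit.BirchSwinnertonDyer.BirchSwinnertonDyer.Theorems.MultTransportTwistedDescent

open NumberField IsDedekindDomain Field WeierstrassCurve CategoryTheory Function
  Literature.NumberTheory.GaloisRepresentations Literature.NumberTheory.EllipticCurves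
  Literature.NumberTheory.GaloisRepresentations.DiscreteGaloisModule IsDedekindDomain.HeightOneSpectrum
  ContinuousCohomology

/-! ## §1 `σ` acts on `μ_N(F̄)` through an exponent -/

section Exponent

variable {F : Type} [Field F]

/-- **Every `σ ∈ Γ_F` acts on `μ_N(F̄)` as `ζ ↦ ζ^a`** for some `a : ℕ`, and there is `a'` with `ζ^{aa'} = ζ`
on `μ_N` (`μ_N(F̄)` is a finite cyclic group, `σ` and `σ⁻¹` carry a generator to powers of it). [folklore]
[cite: SerreGaloisCohomology1997, II §1.2] -/
theorem exists_exponent_rootsOfUnity (σ : absoluteGaloisGroup F) (N : ℕ) [NeZero N] :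
    ∃ a a' : ℕ,
      (∀ ζ : (AlgebraicClosure F)ˣ, ζ ^ N = 1 →
        Units.map (Field.absoluteGaloisGroup.toAlgEquiv F σ : AlgebraicClosure F →* AlgebraicClosure F) ζ =
          ζ ^ a) ∧
      ∀ ζ : (AlgebraicClosure F)ˣ, ζ ^ N = 1 → ζ ^ (a * a') = ζ := by
  obtain ⟨g, hg⟩ := IsCyclic.exists_generator (α := rootsOfUnity N (AlgebraicClosure F))
  have hfin : IsOfFinOrder g := isOfFinOrder_of_finite g
  obtain ⟨a, ha⟩ := (Submonoid.mem_powers_iff _ _).1 ((hfin.mem_powers_iff_mem_zpowers).2 (hg (σ • g)))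
  obtain ⟨a', ha'⟩ := (Submonoid.mem_powers_iff _ _).1 ((hfin.mem_powers_iff_mem_zpowers).2 (hg (σ⁻¹ • g)))
  -- `σ x = x^a` on all of `μ_N`
  have hsmul : ∀ x : rootsOfUnity N (AlgebraicClosure F), σ • x = x ^ a := by
    intro x
    obtain ⟨i, rfl⟩ := Subgroup.mem_zpowers_iff.1 (hg x)
    rw [smul_zpow', ← ha, ← zpow_natCast, ← zpow_natCast, ← zpow_mul, ← zpow_mul, mul_comm]
  -- `g^{a a'} = g`
  have hgaa : g ^ (a * a') = g := by
    have h1 : σ⁻¹ • σ • g = g := inv_smul_smul σ g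
    rwa [← ha, smul_pow', ← ha', ← pow_mul, mul_comm] at h1
  refine ⟨a, a', fun ζ hζ ↦ ?_, fun ζ hζ ↦ ?_⟩
  · have h := congrArg Subtype.val (hsmul ⟨ζ, (mem_rootsOfUnity N ζ).2 hζ⟩)
    rw [Field.absoluteGaloisGroup.coe_smul_rootsOfUnity, SubmonoidClass.coe_pow] at h
    rw [← h]
    exact Units.ext rfl
  · obtain ⟨i, hi⟩ := Subgroup.mem_zpowers_iff.1 (hg ⟨ζ, (mem_rootsOfUnity N ζ).2 hζ⟩)
    have h : (⟨ζ, (mem_rootsOfUnity N ζ).2 hζ⟩ : rootsOfUnity N (AlgebraicClosure F)) ^ (a * a') =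
        ⟨ζ, (mem_rootsOfUnity N ζ).2 hζ⟩ := by
      rw [← hi, ← zpow_natCast, ← zpow_mul, mul_comm, zpow_mul, zpow_natCast, hgaa]
    exact congrArg Subtype.val h

end Exponent

/-! ## §2 The bound `#H²(ℚ_v, C(χ_u)) ≤ |u − 1|` -/

variable (W : WeierstrassCurve ℚ) (κ : ZpExtension ℚ 2) {v : HeightOneSpectrum (𝓞 ℚ)}
  (n : ℕ) (u : ℤ) (hu : (2 : ℤ) ∣ u - 1) [Finite (W.geomTorsion ((2 ^ n : ℕ) : ℤ))]
  (C : Submodule ℤ (W.geomTorsion ((2 ^ n : ℕ) : ℤ)))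
  (hCstab : ∀ σ : absoluteGaloisGroup (v.adicCompletion ℚ), C ≤ C.comap
    (((W.twistedTorsionGaloisModule 2 κ n u hu).restrict (absGaloisRestrict ℚ (v.adicCompletion ℚ))) σ))

/-- **`#H²(ℚ_v, C(χ_u)) ≤ |u − 1|`** for a cyclic `χ_u`-twisted line `C ⊆ E[2^n]` on which some `σ₀` over the
topological generator acts through its exponent on `μ_{2^n}` (see the module docstring for the proof via local
Tate duality in bidegree `(2, 0)`). [cite: SerreGaloisCohomology1997, II §5.2 Thm. 2] [cite: MilneADT2006, I Cor. 2.3]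
[cite: GreenbergLNM1716, §4 pp. 107, 124] -/
theorem natCard_two_line_le (c₀ : W.geomTorsion ((2 ^ n : ℕ) : ℤ)) (hc₀ : c₀ ∈ C)
    (hgen : ∀ c ∈ C, ∃ k : ℕ, c = k • c₀)
    (σ₀ : absoluteGaloisGroup (v.adicCompletion ℚ))
    (hσ₀ : κ (resGal (K := ℚ) (v.adicCompletion ℚ) σ₀) = Multiplicative.ofAdd 1)
    (hσ₀C : ∀ a : ℕ, (∀ ζ : (AlgebraicClosure (v.adicCompletion ℚ))ˣ, ζ ^ 2 ^ n = 1 →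
        Units.map (Field.absoluteGaloisGroup.toAlgEquiv (v.adicCompletion ℚ) σ₀ :
          AlgebraicClosure (v.adicCompletion ℚ) →* AlgebraicClosure (v.adicCompletion ℚ)) ζ = ζ ^ a) →
      ∀ c ∈ C, absGaloisRestrict ℚ (v.adicCompletion ℚ) σ₀ • c = a • c)
    (hu1 : u ≠ 1) :
    Nat.card (continuousCohomology 2 (((W.twistedTorsionGaloisModule 2 κ n u hu).restrict
      (absGaloisRestrict ℚ (v.adicCompletion ℚ))).subrepresentation C hCstab).toTopRep) ≤ (u - 1).natAbs := by
  -- NB: the local-field instance `CharZero ℚ_v` is introduced only AFTER every term mentioning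
  -- `absGaloisRestrict ℚ ℚ_v` has been elaborated (it would switch the `ℚ`-algebra structure of `ℚ_v`
  -- to `DivisionRing.toRatAlgebra`).
  haveI : Fact (Nat.Prime 2) := ⟨Nat.prime_two⟩
  haveI : NeZero (2 ^ n) := ⟨pow_ne_zero _ two_ne_zero⟩
  set R := (W.twistedTorsionGaloisModule 2 κ n u hu).restrict (absGaloisRestrict ℚ (v.adicCompletion ℚ))
    with hR
  set RC := R.subrepresentation C hCstab with hRC
  have ht : ∀ t : W.geomTorsion ((2 ^ n : ℕ) : ℤ), 2 ^ n • t = 0 := fun t ↦ Subtype.ext (by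
    rw [AddSubmonoidClass.coe_nsmul, ZeroMemClass.coe_zero, ← natCast_zsmul]
    exact (mem_geomTorsion_iff W _ _).1 t.2)
  have hnC : ∀ c : C, 2 ^ n • c = 0 := fun c ↦
    Subtype.ext (by rw [AddSubmonoidClass.coe_nsmul, ZeroMemClass.coe_zero]; exact ht _)
  -- the exponent `a` of `σ₀` on `μ_{2^n}`, with inverse `a'`
  obtain ⟨a, a', ha, haa'⟩ := exists_exponent_rootsOfUnity σ₀ (2 ^ n)
  have hCσ := hσ₀C a ha
  -- the twisted action of `σ₀` on `C`: `σ₀ ⋆ c = u • σ₀ c = (u a) • c`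
  have hRσ : ∀ c : C, (RC σ₀ c : C) = (u * a : ℤ) • c := by
    intro c
    apply Subtype.ext
    change W.twistedTorsionGaloisModule 2 κ n u hu (absGaloisRestrict ℚ (v.adicCompletion ℚ) σ₀)
      (c : W.geomTorsion ((2 ^ n : ℕ) : ℤ)) = (((u * a : ℤ) • c : C) : W.geomTorsion ((2 ^ n : ℕ) : ℤ))
    erw [ZpExtension.galoisTwist_apply_of_isTopGenerator _ _ _ _ _ _ hσ₀, torsionGaloisModule_apply_apply]
    rw [WeierstrassCurve.resGal_eq_absGaloisRestrict, hCσ _ c.2, Submodule.coe_smul, mul_smul, natCast_zsmul]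
  -- local Tate duality `(2, 0)`
  haveI : CharZero (v.adicCompletion ℚ) := charZero_adicCompletion v
  haveI : Finite (MuCarrier (v.adicCompletion ℚ) (2 ^ n)) := finite_muCarrier (v.adicCompletion ℚ) (2 ^ n)
  obtain ⟨-, hcard⟩ := natCard_two_eq_natCard_invariants_homRep (v.adicCompletion ℚ) (p := 2) (k := n) RC hnC
  rw [hcard]
  -- the action of `σ₀` on `μ_{2^n}`: `σ₀ ζ = a • ζ`, and `(a a') • ζ = ζ`
  have hμσ : ∀ ζ : MuCarrier (v.adicCompletion ℚ) (2 ^ n), mu (v.adicCompletion ℚ) (2 ^ n) σ₀ ζ = a • ζ := by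
    intro ζ
    have hζ : ((MuCarrier.toAdditive ζ).toMul : (AlgebraicClosure (v.adicCompletion ℚ))ˣ) ^ 2 ^ n = 1 :=
      (mem_rootsOfUnity _ _).1 (MuCarrier.toAdditive ζ).toMul.2
    apply MuCarrier.toAdditive.injective
    rw [mu_apply_apply]
    change Additive.ofMul (σ₀ • (MuCarrier.toAdditive ζ).toMul) =
      Additive.ofMul ((MuCarrier.toAdditive ζ).toMul ^ a)
    congr 1
    apply Subtype.ext
    rw [Field.absoluteGaloisGroup.coe_smul_rootsOfUnity, SubmonoidClass.coe_pow, ← ha _ hζ]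
    exact Units.ext rfl
  have hμaa : ∀ ζ : MuCarrier (v.adicCompletion ℚ) (2 ^ n), (a * a') • ζ = ζ := by
    intro ζ
    have hζ : ((MuCarrier.toAdditive ζ).toMul : (AlgebraicClosure (v.adicCompletion ℚ))ˣ) ^ 2 ^ n = 1 :=
      (mem_rootsOfUnity _ _).1 (MuCarrier.toAdditive ζ).toMul.2
    apply MuCarrier.toAdditive.injective
    change Additive.ofMul ((MuCarrier.toAdditive ζ).toMul ^ (a * a')) = Additive.ofMul (MuCarrier.toAdditive ζ).toMul
    congr 1
    exact Subtype.ext (by rw [SubmonoidClass.coe_pow]; exact haa' _ hζ)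
  -- equivariant maps are killed by `u − 1` at every value
  have hkill : ∀ f ∈ (RC.homRep (mu (v.adicCompletion ℚ) (2 ^ n))).toTopRep.ρ.invariants, ∀ m : C,
      (u - 1) • (f : HomCarrier C (MuCarrier (v.adicCompletion ℚ) (2 ^ n))) m = 0 := by
    intro f hf m
    have h1 : mu (v.adicCompletion ℚ) (2 ^ n) σ₀ (f m) = f (RC σ₀ m) :=
      (ContinuousRep.homRep_apply_eq_self_iff RC _ σ₀ f).1 (hf σ₀) m
    rw [hμσ, hRσ, map_zsmul, ← natCast_zsmul] at h1
    -- `h1 : (a : ℤ) • f m = (u * a) • f m`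
    have h2 : ((a : ℤ) * (u - 1)) • f m = 0 := by
      rw [show (a : ℤ) * (u - 1) = u * a - a by ring, sub_smul, ← h1, sub_self]
    calc (u - 1) • f m = (u - 1) • (((a * a' : ℕ) : ℤ) • f m) := by rw [natCast_zsmul, hμaa]
      _ = (a' : ℤ) • (((a : ℤ) * (u - 1)) • f m) := by
          rw [smul_smul, smul_smul]; congr 1; push_cast; ring
      _ = 0 := by rw [h2, smul_zero]
  -- the injection `f ↦ f(c₀)` into `μ_{2^n}[u − 1]`
  set d := (u - 1).natAbs with hd
  have hd0 : 0 < d := Int.natAbs_pos.2 (sub_ne_zero.2 hu1)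
  have hdkill : ∀ f ∈ (RC.homRep (mu (v.adicCompletion ℚ) (2 ^ n))).toTopRep.ρ.invariants,
      d • (f : HomCarrier C (MuCarrier (v.adicCompletion ℚ) (2 ^ n))) ⟨c₀, hc₀⟩ = 0 := by
    intro f hf
    have h := hkill f hf ⟨c₀, hc₀⟩
    rcases Int.natAbs_eq (u - 1) with h' | h'
    · rw [h', natCast_zsmul] at h; exact h
    · rw [h', neg_smul, neg_eq_zero, natCast_zsmul] at h; exact h
  let e : (RC.homRep (mu (v.adicCompletion ℚ) (2 ^ n))).toTopRep.ρ.invariants →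
      {ζ : MuCarrier (v.adicCompletion ℚ) (2 ^ n) // d • ζ = 0} :=
    fun f ↦ ⟨(f.1 : HomCarrier C (MuCarrier (v.adicCompletion ℚ) (2 ^ n))) ⟨c₀, hc₀⟩, hdkill f.1 f.2⟩
  have he : Injective e := by
    rintro ⟨f, hf⟩ ⟨f', hf'⟩ h
    have h0 : (f : HomCarrier C (MuCarrier (v.adicCompletion ℚ) (2 ^ n))) ⟨c₀, hc₀⟩ =
        (f' : HomCarrier C (MuCarrier (v.adicCompletion ℚ) (2 ^ n))) ⟨c₀, hc₀⟩ := congrArg Subtype.val h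
    apply Subtype.ext
    apply HomCarrier.ext
    rintro ⟨c, hc⟩
    obtain ⟨k, hk⟩ := hgen c hc
    have hck : (⟨c, hc⟩ : C) = k • ⟨c₀, hc₀⟩ := Subtype.ext (by rw [Submodule.coe_smul_of_tower]; exact hk)
    change (f : HomCarrier C (MuCarrier (v.adicCompletion ℚ) (2 ^ n))) ⟨c, hc⟩ =
      (f' : HomCarrier C (MuCarrier (v.adicCompletion ℚ) (2 ^ n))) ⟨c, hc⟩
    rw [hck, map_nsmul, map_nsmul, h0]
  calc Nat.card (RC.homRep (mu (v.adicCompletion ℚ) (2 ^ n))).toTopRep.ρ.invariants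
      ≤ Nat.card {ζ : MuCarrier (v.adicCompletion ℚ) (2 ^ n) // d • ζ = 0} :=
        Nat.card_le_card_of_injective e he
    _ ≤ d := by
        haveI : IsAddCyclic (MuCarrier (v.adicCompletion ℚ) (2 ^ n)) :=
          inferInstanceAs (IsAddCyclic (Additive (rootsOfUnity (2 ^ n) (AlgebraicClosure (v.adicCompletion ℚ)))))
        haveI := Fintype.ofFinite (MuCarrier (v.adicCompletion ℚ) (2 ^ n))
        rw [Nat.card_eq_fintype_card, Fintype.card_subtype]
        exact IsAddCyclic.card_nsmul_eq_zero_le hd0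

/-- **`2^{|u−1|} · H²(ℚ_v, C(χ_u)) = 0`** under the hypotheses of `natCard_two_line_le`: a class `y` has `2`-power
order (the coefficients are killed by `2^n`) dividing `#H²(ℚ_v, C(χ_u)) ≤ |u − 1| < 2^{|u−1|}`.
[cite: SerreGaloisCohomology1997, II §5.2 Thm. 2] [cite: GreenbergLNM1716, §4 pp. 107, 124] -/
theorem two_pow_natAbs_smul_two_line_eq_zero (c₀ : W.geomTorsion ((2 ^ n : ℕ) : ℤ)) (hc₀ : c₀ ∈ C)
    (hgen : ∀ c ∈ C, ∃ k : ℕ, c = k • c₀)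
    (σ₀ : absoluteGaloisGroup (v.adicCompletion ℚ))
    (hσ₀ : κ (resGal (K := ℚ) (v.adicCompletion ℚ) σ₀) = Multiplicative.ofAdd 1)
    (hσ₀C : ∀ a : ℕ, (∀ ζ : (AlgebraicClosure (v.adicCompletion ℚ))ˣ, ζ ^ 2 ^ n = 1 →
        Units.map (Field.absoluteGaloisGroup.toAlgEquiv (v.adicCompletion ℚ) σ₀ :
          AlgebraicClosure (v.adicCompletion ℚ) →* AlgebraicClosure (v.adicCompletion ℚ)) ζ = ζ ^ a) →
      ∀ c ∈ C, absGaloisRestrict ℚ (v.adicCompletion ℚ) σ₀ • c = a • c)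
    (hu1 : u ≠ 1)
    (y : continuousCohomology 2 (((W.twistedTorsionGaloisModule 2 κ n u hu).restrict
      (absGaloisRestrict ℚ (v.adicCompletion ℚ))).subrepresentation C hCstab).toTopRep) :
    2 ^ (u - 1).natAbs • y = 0 := by
  haveI : Fact (Nat.Prime 2) := ⟨Nat.prime_two⟩
  haveI := absoluteGaloisGroup_compactSpace (v.adicCompletion ℚ)
  -- (a `let`, elaborated before the `CharZero` instance enters, see `natCard_two_line_le`)
  let RC := ((W.twistedTorsionGaloisModule 2 κ n u hu).restrict
      (absGaloisRestrict ℚ (v.adicCompletion ℚ))).subrepresentation C hCstab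
  have hle := natCard_two_line_le W κ n u hu C hCstab c₀ hc₀ hgen σ₀ hσ₀ hσ₀C hu1
  have ht : ∀ t : W.geomTorsion ((2 ^ n : ℕ) : ℤ), 2 ^ n • t = 0 := fun t ↦ Subtype.ext (by
    rw [AddSubmonoidClass.coe_nsmul, ZeroMemClass.coe_zero, ← natCast_zsmul]
    exact (mem_geomTorsion_iff W _ _).1 t.2)
  have hnC : ∀ c : C, 2 ^ n • c = 0 := fun c ↦
    Subtype.ext (by rw [AddSubmonoidClass.coe_nsmul, ZeroMemClass.coe_zero]; exact ht _)
  -- `2^n y = 0`, so the order of `y` is a power of `2`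
  have hy : 2 ^ n • y = 0 := by
    have h := ContinuousRep.smul_continuousCohomology_eq_zero RC ((2 ^ n : ℕ) : ℤ)
      (fun c ↦ by rw [Nat.cast_smul_eq_nsmul]; exact hnC c) 2 y
    rwa [Nat.cast_smul_eq_nsmul] at h
  obtain ⟨b, -, hb⟩ := (Nat.dvd_prime_pow Nat.prime_two).1 (addOrderOf_dvd_iff_nsmul_eq_zero.2 hy)
  -- `H²` is finite (local Tate duality), so `2^b = addOrderOf y ∣ #H² ≤ |u - 1| < 2^{|u-1|}`
  haveI : CharZero (v.adicCompletion ℚ) := charZero_adicCompletion v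
  obtain ⟨hfin, -⟩ := natCard_two_eq_natCard_invariants_homRep (v.adicCompletion ℚ) (p := 2) (k := n) RC hnC
  have hdvd : addOrderOf y ∣ Nat.card (continuousCohomology 2 RC.toTopRep) := addOrderOf_dvd_natCard y
  have hpos : 0 < Nat.card (continuousCohomology 2 RC.toTopRep) := Nat.card_pos_iff.2 ⟨⟨y⟩, hfin⟩
  have hble : 2 ^ b ≤ (u - 1).natAbs := (hb ▸ Nat.le_of_dvd hpos hdvd).trans hle
  have hblt : b < (u - 1).natAbs :=
    (Nat.pow_lt_pow_iff_right (by norm_num : 1 < 2)).1 (hble.trans_lt Nat.lt_two_pow_self)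
  apply addOrderOf_dvd_iff_nsmul_eq_zero.1
  rw [hb]
  exact pow_dvd_pow 2 hblt.le

end Summit.BirchSwinnertonDyer.BirchSwinnertonDyer.Theorems.MultTransportTwistedDescent

end
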